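import Mathlib
import HarnessLib
import HarnessLib.Audit
import Summits.NavierStokesRegularity.Statement
import Literature.Analysis.FluidPDE.ClassicalSolution
import Literature.Analysis.FluidPDE.LerayHopf
import Literature.Analysis.FluidPDE.SuitableWeak
import Literature.Analysis.FluidPDE.NSWave0
import Summits.NavierStokesRegularity.NavierStokesRegularity.Theorems.TypeICertificateLadderNoBlowupToClay
import HarnessLib.Audit.Status.Attr

/-!
Route: CoreLogGas

# Route CoreLogGas — NavierStokesRegularity (Clay A), positive side (vortex-core hyperbolic
structure; card filament-loggas-drainage-law)

## Thesis X = A ∧ B ("it suffices to show"), an alternative decomposition of NoTypeII (shared target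
stmt-0056), closed off by the shared unconditional Type-I exclusion NoTypeIBlowup (stmt-1217) — no
Literature conjecture is imported (rev 3: (L) = LiouvilleConjectureNS is no longer an item of this
route; it stays in route TypeILiouville as one way to prove NoTypeIBlowup)
Dictionary (physical analogy made explicit): along an intense vortex core, (core area A, axial
velocity w) obey the forced Lundgren–Ashurst system A_t + (Aw)_s = −σA, w_t + w w_s = −∂_s(−κ/A) +
f, κ = Γ²/4π (Γ = vorticity flux, Helmholtz-invariant along the tube): 1-D isentropic gas dynamics
with density A, pressure P = κ ln A, sound speed c = (κ/A)^{1/2} = peak swirl speed, Riemann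
invariants w ∓ 2c. Since c → ∞ at vacuum, bounded invariants forbid A → 0: a core cannot pinch
(|ω|_core ≈ Γ/A stays bounded) unless the EXTERNAL axial strain σ / acceleration f it feels is
non-integrable in time (support LogGasNoVacuum: 4c(t) ≤ (M₀ + 2Ft)·exp(St/2) for ANY smooth (A,w),
σ̃,f̃ := the residuals). External forcing at the core scale can only come from vorticity OUTSIDE the
core; so a singularity is either LOCALLY DRIVEN (everything that strains the peak lives within
boundedly many core radii: lone tube — impossible by the log-gas; tight binary or isotropic blob —
circulation-driven, hence Type I) or driven from outside in core units (sheets; excluded by B).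
A (LocallyDrivenIsTypeI): a maximal finite-energy classical solution from Clay data whose deep
near-maximum vorticity points feel, from the vorticity outside M inscribed-core radii, only a
time-integrable strain, blows up at the Type I rate.
B (BlowupIsLocallyDriven): every maximal finite-energy classical solution from Clay data satisfies
that hypothesis for some M ≥ 1 on some [t₀,T*).
Lean (all decls elaborate, planner Sketch2.lean rc 0; H(M,t₀,g) := ∀ t ∈ Ico t₀ T, ∀ x ρ, 0<ρ →
sup|ω(t)| ≤ 2|ω(t,x)| → ball x ρ ⊆ {sup|ω(t)| ≤ 4|ω(t,·)|} → (ρ ≥ half the largest such radius) → ∀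
unit e, |⟪(∇u(t,x) − ∇[BS(1_{ball x (Mρ)} ω(t))](x)) e, e⟫| ≤ g t, g integrable on Ico t₀ T; the
Biot–Savart velocity is WRITTEN OUT, BS F z := ∫ y, (4π‖z−y‖³)⁻¹ • (F y × (z−y)) with the in-tree
`cross`, definitionally equal to the in-tree `biotSavart F z` (ANew ↔ AOld and BNew ↔ BOld by
Iff.rfl, checked), so that the route file imports only ClassicalSolution / LerayHopf / SuitableWeak
/ NSWave0):
 A: ∀ ν T>0 ∀ u p, IsMaximalSmoothSolution ν 0 u p T → IsLerayHopfOn T ν 0 (u 0) u →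
HasRapidSpatialDecay (u 0) → (∃ M t₀ g, 1 ≤ M ∧ … ∧ H) → IsTypeIBlowup u T
 B: same hypotheses → ∃ M t₀ g, 1 ≤ M ∧ 0 ≤ t₀ < T ∧ IntegrableOn g (Ico t₀ T) ∧ H
A ∧ B → NoTypeII (2 lines, checked). DECIDING THEOREM (in the route file, sorry-free, axioms
propext/Classical.choice/Quot.sound): closes : LocallyDrivenIsTypeI → BlowupIsLocallyDriven →
NoTypeIBlowup → NoBlowupToClay → NavierStokesRegularity — fix ν,T,u,p as in NoBlowupToClay's
hypothesis; if u had no smooth extension past T then (u,p) is IsMaximalSmoothSolution, B supplies H,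
A gives IsTypeIBlowup u T, NoTypeIBlowup gives HasSmoothExtensionPast: contradiction; NoBlowupToClay
(stmt-0055) converts to Clay (A). NoTypeIBlowup (stmt-1217: a classical Leray–Hopf solution from
decaying data with the Type-I rate on [0,T) extends past T) is shared with ThreadingFlux /
TypeICertificateLadder / OddMorawetz / AdaptedFrequency and is the unconditional conclusion of
TypeILiouville's (L)-lemma stmt-0058.

Rationale: WHY THIS LINE. Card filament-loggas-drainage-law (graded new-combination). The intense set of every
simulated near-singular NS flow is a vortex CORE, and cores carry a structure energy methods cannot
see: Helmholtz's flux Γ is constant along a tube, the cyclostrophic pressure deficit is −Γ²/(4πA),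
and the slender-core equations of LundgrenAshurst1989/Marshall1991 are 1-D isentropic gas dynamics
with P = κ ln A (Benjamin1962's super/subcritical cores = w/c ≷ 1). NEW USE: the Riemann invariants
w ∓ 2c as a one-sided law — c = (κ/A)^{1/2} → ∞ at vacuum, so NO PINCH-OFF under integrable external
forcing, with the explicit amplification bound 4c ≤ (M₀+2Ft)e^{St/2} (support LogGasNoVacuum, stated
as a comparison inequality for ARBITRARY smooth (A,w), hence immune to modelling error: all error
sits in the residual bounds S,F). Consequence: a lone slender tube cannot blow up (bending is cubic
NLS/Klein–Majda, globally regular, book:majda2002-vorticity-incompressible-flow PDF p.238); blow-up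
needs forcing at the core scale from OUTSIDE the core = a second structure at distance O(a) (binary;
KleinMajdaDamodaran1995 pair collapse, MB2002 PDF pp.258–261; BanicaFaouMiot2016 self-similar
collisions d ~ (Γ(T−t))^{1/2}; DNS YaoHussain2020Separation p.3: δ = A±(Γ|t−t₀|)^{1/2}) or isotropic
focusing — both circulation-driven, |u| ≲ Γ/d, hence Type I — or a SHEET (no mechanism; the honest
gap). Imported areas: hyperbolic conservation laws (Riemann invariants / invariant regions),
matched-asymptotics vortex-core theory, filament Schrödinger dynamics. The typed cruxes A/B render
this WITHOUT positing tube geometry: 'core radius' := inscribed quarter-max ball at a near-max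
vorticity point, 'external strain' := ∇u minus the gradient of the Biot–Savart velocity of the
vorticity inside M core radii (Biot–Savart integral written out over the in-tree cross/curl; =
in-tree biotSavart by rfl), symmetric part only (far segments of the same straight tube induce
rotation, not strain, at the axis).
RANKED CRUXES. #2 NoTypeIBlowup = Type-I exclusion for Clay data (shared stmt-1217, wanted by five
routes; the hardest input the deciding theorem consumes, ranked first; this route adds nothing to it
— known partial proofs: (L) ⇒ it (KNSS2009 / SereginSverak2009 zoom-in, route TypeILiouville),
backward self-similar excluded (NecasRuzickaSverak1996, Tsai1998), λ-DSS for λ < λ_*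
(ChaeWolf2017Removing), axisymmetric (KNSS2009 Thm 6.2)). #3 A LocallyDrivenIsTypeI (own; Kelvin
budget: under H all velocity near the peak is induced by local vorticity of flux ≤ Γ₀ at distances ≳
a, |u| ≲ Γ₀/a, and mutual induction closes distances no faster than d² ≳ Γ₀(T−t); the lone-tube
sub-case is even non-singular by the log-gas). #4 B BlowupIsLocallyDriven (own; the structure claim:
near T* deep peak points are not strained non-integrably from beyond M core radii — true for tubes,
tight binaries (d/a ~ Re_Γ^{1/2} by Burgers balance a² ~ νd²/Γ) and blobs; FALSE for a collapsing
sheet). Support: LogGasNoVacuum (provable now: Danskin + Grönwall on sup(w+2c) − inf(w−2c)),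
CoreReductionContinuation (= LogGasNoVacuum + Beale–Kato–Majda in-tree
beale_kato_majda/MajdaBertozzi2002_bkmAprioriH3: a solution whose vorticity max is dominated by
Kκ/min A of a log-gas pair with bounded residuals extends), NoBlowupToClay (stmt-0055); target
NoTypeII (stmt-0056) ⇐ A ∧ B. Rev 3 (cone re-route): Liouville (stmt-0057) and LiouvilleKillsTypeI
(stmt-0058) dropped from THIS route (they stay in TypeILiouville) in favour of their unconditional
consequence NoTypeIBlowup; the Assembly item is restated as A → B → NoTypeIBlowup → NoBlowupToClay →
NavierStokesRegularity, the mirror of the PROVED deciding theorem `closes` (one-line proof from it).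
TWO-LAYER PLAN (foreseen, NOT filed — D-0019): B ⇐ Trichotomy (deep peak components are
tube- /blob- /sheet-like) ∧ LoneTubeExcluded (a-posteriori VALIDITY of the Lundgren–Ashurst reduction
for the true core: residuals S,F bounded by collar vorticity W₀ + d₀^{-3/2}‖ω(t)‖₂ (∫‖ω‖₂ < ∞ by the
energy inequality) + O(Λ^{-1}) slenderness errors, then CoreReductionContinuation) ∧ SheetExcluded
(open; Kelvin–Helmholtz roll-up?) ; A ⇐ KelvinBudget (binary/blob ⇒ ‖u(t)‖∞ ≤ C(Γ₀/(T*−t))^{1/2}).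
Axisymmetric calibration: Γ = r u_θ has a maximum principle (in-tree swirl_transport; LeiZhang2017),
Type I is already excluded there (knss_no_axisymmetric_typeI), and Hou's scenario (arXiv:2107.06509)
sits at a CIRCULATION NODE on the axis (Γ(z) changes sign at z = 0, so κ = 0: no cyclostrophic
support) inside a pancake of radial 'hedgehog' vorticity ω_r — the sheet regime, i.e. exactly B's
declared failure mode; reading Hou's data in (A,w,σ) variables is the cheapest test (kit job for a
refuter).
KILL CRITERIA. (i) ¬B by ANY maximal solution (e.g. Hou's scenario certified singular: sheet-driven,
Type II by KNSS2009 p.4) closes the route `refuted:BlowupIsLocallyDriven` and is ¬Clay(A) outright.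
(ii) ¬A: a locally driven Type-II blow-up (model inhabitant: a lone blob relaying to a daughter
blob, Tao2016AveragedNS cascade geometry) — close refuted. (iii) A smooth counterexample to
LogGasNoVacuum (cannot exist if the algebra R∓_t + (w∓c)R∓_s = f̃ ± σ̃c is right — checked by hand
twice) would void the mechanism: close. (iv) ¬NoTypeIBlowup, i.e. a finite-energy Type-I singularity
from Clay data (¬Clay(A) outright; a nontrivial Type-I ancient mild solution, AlbrittonBarker2019
Thm 1.1, is the expected companion) kills #2 for all five routes sharing it: pivot A's conclusion
from 'Type I rate' to 'extension' (the log-gas gives that much for tubes) or close superseded. (v)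
NoBlowup (stmt-0054) proved elsewhere moots the route.
NOT DECOMPOSED YET (deliberately): the tube/blob/sheet trichotomy lemma and any definition of
'tube-like' (curves, tubular neighbourhoods) — layer 2, only after A or B moves; weak/shock
solutions of the log-gas (NOT needed: (A,w) come from a smooth NS flow; NB the Chueh–Conley–Smoller
invariant-region route FAILS here — for P = κ ln A the Riemann-invariant sublevel sets {m ≤ bA −
2(κA)^{1/2}} are NON-convex in conserved variables, so Lax–Friedrichs/Godunov limits need not
respect them; the card's 'shocks included' is withdrawn); the 'supersonic drainage |w| ≥ 2c' reading
(valid for one-sided pumping only; at a symmetric stagnation pinch w = 0 — withdrawn as a law, kept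
as heuristic); binormal/NLS bending control; reconnection and circulation non-conservation
(YaoHussain2020).
CHEAPEST FALSIFIER. Read Hou's axisymmetric candidate (arXiv:2107.06509, published profiles) in (ρ =
inscribed quarter-max radius, external symmetric strain from beyond Mρ) variables: if for every M
the deep vorticity maximum is strained at a non-integrable rate from outside M core radii (sheet at
a circulation node) and the scenario is certified singular, B is refuted (and Clay (A) with it); one
kit job. Cheaper still, for the mechanism: a CAS check of the two Riemann-invariant identities
behind LogGasNoVacuum ((w±2c)_t + (w∓c)(w±2c)_s = f̃ ± σ̃c) — a sign error voids the log-gas.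
NUMBERS. Items after rev 3: 8 (3 cruxes — shared NoTypeIBlowup + own A, B —, 3 support, target
NoTypeII, assembly) + the deciding theorem `closes` (proved); own typed decls 4 (A, B,
LogGasNoVacuum, CoreReductionContinuation), all rc 0; A ∧ B → NoTypeII proved (Sketch2.lean). Import
cone: route imports 4 Literature files (closure 16 modules); unproved named facts in the cone 11 →
3, the residual 3 being Clay (B)/(C)/(D) (NavierStokesExistenceSmoothPeriodic,
NavierStokesBreakdownR3, NavierStokesBreakdownPeriodic in NSWave0), imported by the sub-problem
Statement itself and used by nothing here. Known: Type I excluded only under (L) or axisymmetry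
(KNSS2009 Thms 5.2–5.3, 6.1–6.2); filament pair collapse rate d ~ (Γ(T−t))^{1/2}
(BanicaFaouMiot2016; DNS prefactor Re-dependent, YaoHussain2020Separation p.2); MoffattKimura2019
Part 2: model singularity 'averted' by core deformation/reconnection; vorticity amplification in DNS
of colliding rings ×O(10) only (YaoHussain2020).

Novelty: NOVELTY (searched 2026-08-15: lit search --source crossref on 'Lundgren Ashurst area-varying waves'
(doi:10.1017/s0022112089000662, Leonard 1994 doi:10.1063/1.868315), 'Riemann invariants vortex core
area axial velocity gas dynamics analogy' (nearest: Callegari–Ting 1978 doi:10.1137/0135013,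
Cohn–Koochesfahani 1993 — no Riemann-invariant use), Moffatt–Kimura Parts 1–3
(doi:10.1017/jfm.2018.882, 10.1017/jfm.2019.263, 10.1017/jfm.2023.472), Banica–Faou–Miot
(doi:10.1002/cpa.21637), Klein–Majda–Damodaran (doi:10.1017/s0022112095001121), Yao–Hussain
(doi:10.1017/jfm.2020.58, arXiv:2006.05796 read p.2–3), Marshall1991, Benjamin1962; lit search
--hybrid and lit vsearch on 'core area cannot collapse / Riemann invariants log pressure law' (only
book:majda2002-vorticity-incompressible-flow ch.7, read PDF pp.237–240, 258–263); galaxy --star all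
substring (0 hits, 2 queries); plus the card's audited searches (refuter novelty audit 2026-08-15:
arXiv:1512.07898, arXiv:1809.03578, arXiv:1005.4195, arXiv:2107.06509).
Nearest prior art: (a) LundgrenAshurst1989 / Benjamin1962 / Marshall1991 / Leonard 1994: the (A,w)
core system, its gas-dynamics–shallow-water analogy, steepening and shocks = vortex breakdown,
super/subcritical cores — the MODEL, never used as a maximum principle against pinch-off or tied to
NS regularity; (b) MoffattKimura2018/MoffattKimura2019, Childress–Gilbert–Valiant arXiv:1512.07898,
YaoHussain2020: core deformation / pressure-driven axial flow 'averts' model singulariti  [refs: 10.1017/s0022112089000662, 10.1063/1.868315, 10.1137/0135013, 10.1017/jfm.2018.882, 10.1017/jfm.2019.263, 10.1017/jfm.2023.472, 10.1002/cpa.21637, 10.1017/s0022112095001121, 10.1017/jfm.2020.58, 2006.05796, 1512.07898, 1809.03578, 1005.4195, 2107.06509, doi:10.1017/s0022112089000662, doi:10.1063/1.868315, doi:10.1137/0135013, doi:10.1017/jfm.2018.882, doi:10.1002/cpa.21637, doi:10.1017/s0022112095]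

Barriers (technique_class: vortex-core-asymptotics riemann-invariants type-I-blowup-rate): technique_class: vortex-core-asymptotics riemann-invariants type-I-blowup-rate
(also: regime-decomposition, supercritical-a-priori-control)
- Literature.Barriers.NavierStokesRegularity.EnergySupercriticality: APPLIES to cruxes A and B (both
are large-data a-priori statements about blow-up). Not evaded globally; the bet is Tao's evasion
classes (d)/(e): a scale-invariant, COHERENT-STRUCTURE-internal controlled quantity — the
dimensionless Riemann invariants (w ∓ 2c)/c of the core log-gas, resting on Helmholtz flux
invariance along vortex tubes and the cyclostrophic pressure law — replaces the energy inside the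
structure, while the energy inequality is used only far from the core (∫₀ᵀ‖ω‖₂ dt < ∞ bounds the
far-field strain in layer 2). The barrier bites in B's sheet branch, conceded as the failure mode.
- Literature.Barriers.NavierStokesRegularity.TaoAveragedBlowup: evaded IN KIND, not yet in deed:
every ingredient (vortex lines transported by the true velocity, flux constant along a tube,
Biot–Savart geometry of the strain split, pressure = −Γ²/(4πA) from centrifugal balance) is a
property of the exact Euler bilinear form that an averaged B̃ does not share; conversely crux A
would be FALSE for Tao's cascade geometry (a lone blob handing over to a daughter blob is 'locally
driven' yet Type II), so any proof of A must use that fine structure — recorded as A's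
why-might-fail.
- Literature.Barriers.NavierStokesRegularity.TruncatedDyadicTypeIBlowup: the route does not EXCLUDE
Type

Novelty grade: new-combination — ROUTE REVIEW (refuter 2026-08-15). All 9 decls rc0; full Assembly and A∧B→NoTypeII proved sorry-free (evidence on stmt-2086). Junk audit of own cruxes A(2087)/B(2088): Real.iSup ‖ω(t,·)‖ is the true sup for t<T (strong-solution boundedness via weak–strong uniqueness + CKN: named facts, true in subst (refuter refuter-rreview-route-PneNP-EcdlpDefinab-f574c8f2-0, 2026-08-15T13:59:52Z; prior: LundgrenAshurst1989 doi:10.1017/s0022112089000662, Leonard1994 doi:10.1063/1.868315, KNSS2009, BealeKatoMajda1984, MoffattKimura2019 doi:10.1017/jfm.2019.263, BanicaFaouMiot2016 doi:10.1002/cpa.21637)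

History (route lifecycle, newest last):
- 2026-08-15T16:59:44Z · rev 3: restated LocallyDrivenIsTypeI (stmt-NavierStokesRegularity-2087), BlowupIsLocallyDriven (stmt-NavierStokesRegularity-2088), Assembly (stmt-NavierStokesRegularity-2086) — route-repair rbadge-NavierStokesRegularity-CoreLogG-1741f1bb-g2 (cone re-route, step 2/2). needs-fact: NONE of the 11 unproved cone facts is us (planner-rbadge-NavierStokesRegularity-CoreLogG-1741f1bb-g2-0)
- 2026-08-15T16:59:44Z · rev 3: dropped Liouville, LiouvilleKillsTypeI — route-repair rbadge-NavierStokesRegularity-CoreLogG-1741f1bb-g2 (cone re-route, step 2/2). needs-fact: NONE of the 11 unproved cone facts is used by this line. (planner-rbadge-NavierStokesRegularity-CoreLogG-1741f1bb-g2-0)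

sub-problem: NavierStokesRegularity · status: open · opened planner-plancard-NavierStokesRegularity-Navie-1d1a7326-0 2026-08-15T11:00:38Z · rev 3 · ledger route-NavierStokesRegularity-CoreLogGas
GENERATED by the gate from the ledger (D-0016/17). Provers cite these decls: `theorem foo : Summit.NavierStokesRegularity.NavierStokesRegularity.Theses.CoreLogGas.<Decl> := …` in Summits/NavierStokesRegularity/NavierStokesRegularity/Theorems/<Name>.lean.
-/

namespace Summit.NavierStokesRegularity.NavierStokesRegularity.Theses.CoreLogGas

open scoped BigOperators Topology Manifold Classical MeasureTheory ProbabilityTheory Matrix InnerProductSpace ComplexConjugate ContinuousMap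
open Filter Set Function TopologicalSpace MeasureTheory

attribute [summit_statement] _root_.NavierStokesRegularity

open Literature.NS

/-- item stmt-NavierStokesRegularity-0056 · target · rank 0 · open · by planner
why it might fail: Any Type II singularity refutes it and is ¬Clay(A): Hou's axisymmetric candidate (arXiv:2107.06509) would have to be Type II (KNSS2009 p.4, Thm 6.2); Tao's averaged blow-up is Type II.
sources: KNSS2009, Hou2022PotentiallySingularNS, arXiv:2107.06509, Tao2016AveragedNS
If a finite-energy classical solution from a rapidly decaying datum has maximal lifespan T<∞ (no
classical extension past T), then ‖u(t)‖_∞ ≤ C (T−t)^{-1/2} eventually as t↑T (Leray's rate is the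
matching lower bound, leray_blowup_rate_top). The hardest and most informative crux: a
counterexample is a Type II singularity, i.e. ¬(Clay A). Known: lower bound c√ν (T−t)^{-1/2} (Leray
1934 §20); L³ must blow up (ESS 2003, Seregin 2012); only triple-log quantitative gain (Tao 2021). -/
@[route_item "route-NavierStokesRegularity-CoreLogGas", crux]
def NoTypeII : Prop :=
  ∀ (ν T : ℝ), 0 < ν → 0 < T → ∀ (u : ℝ → EuclideanSpace ℝ (Fin 3) → EuclideanSpace ℝ (Fin 3)) (p : ℝ → EuclideanSpace ℝ (Fin 3) → ℝ), Literature.Analysis.FluidPDE.IsMaximalSmoothSolution ν 0 u p T → Literature.Analysis.FluidPDE.IsLerayHopfOn T ν 0 (u 0) u → Literature.Analysis.FluidPDE.HasRapidSpatialDecay (u 0) → Literature.Analysis.FluidPDE.IsTypeIBlowup u T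

/-- item stmt-NavierStokesRegularity-1217 · crux · rank 2 · open · by planner
why it might fail: A finite-energy Type-I singularity may exist: Type-I exclusion ⇔ Liouville for Type-I ancient mild solutions (AlbrittonBarker2019 Thm 1.1), open beyond axisymmetry (KNSS2009 p.3, Thm 6.2); λ-DSS blow-up excluded only for λ < λ_* (ChaeWolf2017Removing).
sources: KNSS2009, SereginSverak2009, AlbrittonBarker2019, ChaeWolf2017Removing, NecasRuzickaSverak1996, Tsai1998
[target] X = NO TYPE-I BLOW-UP FOR CLAY DATA: a classical solution of unforced NS on ℝ³×[0,T) which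
is Leray–Hopf from a rapidly decaying datum and blows up at most at the Type-I rate ‖u(t)‖∞ ≤
C(T−t)^{-1/2} extends smoothly past T. Equals UnthreadedNoBlowup ∧ ThreadedNoBlowup by excluded
middle on 'every point is unthreaded' (proved in the planner's Sketch.lean: target_of_cruxes); it is
the unconditional conclusion of stmt-NavierStokesRegularity-0058 (route TypeILiouville, which
assumes (L)). With NoTypeII (stmt-0056) it gives NoBlowup (stmt-0054). Card:
threading-flux-trace-topology. -/
@[route_item "route-NavierStokesRegularity-CoreLogGas", crux]
def NoTypeIBlowup : Prop :=
  ∀ (ν T : ℝ), 0 < ν → 0 < T → ∀ (u : ℝ → EuclideanSpace ℝ (Fin 3) → EuclideanSpace ℝ (Fin 3)) (p : ℝ → EuclideanSpace ℝ (Fin 3) → ℝ), Literature.Analysis.FluidPDE.IsClassicalNSSolutionOn (Set.Ico 0 T) ν 0 u p → Literature.Analysis.FluidPDE.IsLerayHopfOn T ν 0 (u 0) u → Literature.Analysis.FluidPDE.HasRapidSpatialDecay (u 0) → Literature.Analysis.FluidPDE.IsTypeIBlowup u T → Literature.Analysis.FluidPDE.HasSmoothExtensionPast ν 0 u T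

-- earlier LocallyDrivenIsTypeI (stmt-NavierStokesRegularity-2087, replaced 2026-08-15T16:59:44Z -> stmt-NavierStokesRegularity-11290): retired by None — ∀ (ν T : ℝ), 0 < ν → 0 < T → ∀ (u : ℝ → EuclideanSpace ℝ (Fin 3) → EuclideanSpace ℝ (Fin 3)) (p : ℝ → EuclideanSpace ℝ (Fin 3) → ℝ), Literature.Analysis.FluidPDE.IsMaximalSmoothSolution ν 0 u p T → Literature.Analysis.FluidPDE.IsLerayHopfOn T ν 0 (u
/-- item stmt-NavierStokesRegularity-11290 · crux · rank 3 · open · by planner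
why it might fail: A lone blob relaying to an ever smaller daughter blob is 'locally driven' yet Type II in Tao's averaged cascade (Tao2016AveragedNS §5); circulation is not conserved through viscous reconnection (YaoHussain2020) and the collapse prefactor is Re-dependent (arXiv:2006.05796 p.2).
sources: Tao2016AveragedNS, KleinMajdaDamodaran1995, BanicaFaouMiot2016, YaoHussain2020, YaoHussain2020Separation, MajdaBertozzi2002
[crux] A — LOCALLY DRIVEN BLOW-UP IS TYPE I (card filament-loggas-drainage-law, regimes (P) pinching
/ (I) interaction). Hypothesis H(M,t₀,g): for every t ∈ [t₀,T*) and every DEEP near-maximum point x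
of |ω(t)| — |ω(t,x)| ≥ ½ sup|ω(t)|, with an inscribed ball B(x,ρ) of the quarter-max set {|ω(t)| ≥ ¼
sup} whose radius ρ is at least half the largest such radius (ρ = the canonical core radius a(t);
for a tube its thickness, for a sheet its thickness, for a blob its size) — the SYMMETRIC part of
the velocity gradient induced at x by the vorticity OUTSIDE B(x,Mρ), i.e. of ∇u(t,x) −
∇(BS[1_{B(x,Mρ)}ω(t)])(x), where BS F z := ∫ (4π‖z−y‖³)⁻¹ (F y × (z−y)) dy is the Biot–Savart
velocity written out over the in-tree cross/curl (rev 3: definitionally the in-tree biotSavart,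
inlined only to keep Vorticity.lean out of the import cone; u = BS ω for decaying fields), is ≤ g(t)
with ∫_{t₀}^{T*} g < ∞. Claim: then ‖u(t)‖∞ ≤ C(T*−t)^{-1/2} eventually. Mechanism: under H all
forcing of the peak lives within M core radii — a lone tube (then even NO blow-up: Riemann
invariants of the core log-gas, LogGasNoVacuum + CoreReductionContinuation through the layer-2
validity item), a tight binary or an isotr -/
@[route_item "route-NavierStokesRegularity-CoreLogGas", crux]
def LocallyDrivenIsTypeI : Prop :=
  ∀ (ν T : ℝ), 0 < ν → 0 < T → ∀ (u : ℝ → EuclideanSpace ℝ (Fin 3) → EuclideanSpace ℝ (Fin 3)) (p : ℝ → EuclideanSpace ℝ (Fin 3) → ℝ), Literature.Analysis.FluidPDE.IsMaximalSmoothSolution ν 0 u p T → Literature.Analysis.FluidPDE.IsLerayHopfOn T ν 0 (u 0) u → Literature.Analysis.FluidPDE.HasRapidSpatialDecay (u 0) → (∃ (M t₀ : ℝ) (g : ℝ → ℝ), 1 ≤ M ∧ 0 ≤ t₀ ∧ t₀ < T ∧ MeasureTheory.IntegrableOn g (Set.Ico t₀ T) ∧ ∀ t ∈ Set.Ico t₀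 T, ∀ (x : EuclideanSpace ℝ (Fin 3)) (ρ : ℝ), 0 < ρ → (⨆ z, ‖Literature.Analysis.FluidPDE.curl (u t) z‖) ≤ 2 * ‖Literature.Analysis.FluidPDE.curl (u t) x‖ → Metric.ball x ρ ⊆ {y | (⨆ z, ‖Literature.Analysis.FluidPDE.curl (u t) z‖) ≤ 4 * ‖Literature.Analysis.FluidPDE.curl (u t) y‖} → (∀ (x' : EuclideanSpace ℝ (Fin 3)) (ρ' : ℝ), (⨆ z, ‖Literature.Analysis.FluidPDE.curl (u t) z‖) ≤ 2 * ‖Literature.Analysis.FluidPDE.curl (u t) x'‖ → Metric.ball x' ρ' ⊆ {y | (⨆ z, ‖Literature.Analysis.FluidPDE.curl (u t) z‖) ≤ 4 * ‖Literature.Analysis.FluidPDE.curl (u t) y‖} → ρ' ≤ 2 * ρ) → ∀ e : EuclideanSpace ℝ (Fin 3), ‖e‖ = 1 → |inner ℝ ((fderiv ℝ (u t) x - fderiv ℝ (fun z : EuclideanSpace ℝ (Fin 3) => ∫ y, (4 * Real.pi * ‖z - y‖ ^ 3)⁻¹ • Literature.Analysis.FluidPDE.cross ((Metric.ball x (M *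 ρ)).indicator (Literature.Analysis.FluidPDE.curl (u t)) y) (z - y)) x) e) e| ≤ g t) → Literature.Analysis.FluidPDE.IsTypeIBlowup u T

-- earlier BlowupIsLocallyDriven (stmt-NavierStokesRegularity-2088, replaced 2026-08-15T16:59:44Z -> stmt-NavierStokesRegularity-11291): retired by None — ∀ (ν T : ℝ), 0 < ν → 0 < T → ∀ (u : ℝ → EuclideanSpace ℝ (Fin 3) → EuclideanSpace ℝ (Fin 3)) (p : ℝ → EuclideanSpace ℝ (Fin 3) → ℝ), Literature.Analysis.FluidPDE.IsMaximalSmoothSolution ν 0 u p T → Literature.Analysis.FluidPDE.IsLerayHopfOn T ν 0 (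
/-- item stmt-NavierStokesRegularity-11291 · crux · rank 4 · open · by planner
why it might fail: Sheets: Hou's axisymmetric candidate (arXiv:2107.06509) concentrates |ω| in a pancake of radial vorticity at a circulation node, where H fails for every M; if it is a true singularity B is false (and ¬Clay A). No sheet roll-up/trichotomy lemma is known.
sources: Hou2022PotentiallySingularNS, arXiv:2107.06509, LundgrenAshurst1989, Marshall1991, ConstantinFefferman1993, MoffattKimura2018
[crux] B — BLOW-UP IS LOCALLY DRIVEN (the structure theorem of the card's regime decomposition).
Every maximal finite-energy classical solution from Clay data admits M ≥ 1, t₀ < T* and an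
integrable g with H(M,t₀,g) exactly as in LocallyDrivenIsTypeI (Biot–Savart velocity written out;
rev 3). Content: near T* the deep peak points of |ω| are not strained non-integrably by vorticity
beyond M of their OWN core radii — the singularity is a lone core, a tight binary (d/a bounded:
Burgers balance a² ~ νd²/Γ gives d/a ~ Re_Γ^{1/2}) or a blob; never a collapsing SHEET (for a sheet
of thickness a and extent L ≫ a the part beyond Ma strains the peak at rate ~ |ω|_max/M,
non-integrable) and never 'action at a distance in core units' (a far eddy of circulation Γ_L at
distance L strains at the bounded rate Γ_L/L²). Where the log-gas enters: the lone slender tube is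
the branch in which H holds with room to spare (straight far segments of the tube induce rotation,
not strain, at the axis; curvature adds O(Γκ/(Ma)); cubic-NLS bending is globally regular,
Klein–Majda, book:majda2002-vorticity-incompressible-flow PDF p.238) and in which the
Lundgren–Ashurst reduction (A = core area, w = axial veloci -/
@[route_item "route-NavierStokesRegularity-CoreLogGas", crux]
def BlowupIsLocallyDriven : Prop :=
  ∀ (ν T : ℝ), 0 < ν → 0 < T → ∀ (u : ℝ → EuclideanSpace ℝ (Fin 3) → EuclideanSpace ℝ (Fin 3)) (p : ℝ → EuclideanSpace ℝ (Fin 3) → ℝ), Literature.Analysis.FluidPDE.IsMaximalSmoothSolution ν 0 u p T → Literature.Analysis.FluidPDE.IsLerayHopfOn T ν 0 (u 0) u → Literature.Analysis.FluidPDE.HasRapidSpatialDecay (u 0) → ∃ (M t₀ : ℝ) (g : ℝ → ℝ), 1 ≤ M ∧ 0 ≤ t₀ ∧ t₀ < T ∧ MeasureTheory.IntegrableOn g (Set.Ico t₀ T) ∧ ∀ t ∈ Set.Ico t₀ T, ∀ (x : EuclideanSpace ℝ (Fin 3)) (ρ : ℝ), 0 < ρ → (⨆ z, ‖Literature.Analysis.FluidPDE.curl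 (u t) z‖) ≤ 2 * ‖Literature.Analysis.FluidPDE.curl (u t) x‖ → Metric.ball x ρ ⊆ {y | (⨆ z, ‖Literature.Analysis.FluidPDE.curl (u t) z‖) ≤ 4 * ‖Literature.Analysis.FluidPDE.curl (u t) y‖} → (∀ (x' : EuclideanSpace ℝ (Fin 3)) (ρ' : ℝ), (⨆ z, ‖Literature.Analysis.FluidPDE.curl (u t) z‖) ≤ 2 * ‖Literature.Analysis.FluidPDE.curl (u t) x'‖ → Metric.ball x' ρ' ⊆ {y | (⨆ z, ‖Literature.Analysis.FluidPDE.curl (u t) z‖) ≤ 4 * ‖Literature.Analysis.FluidPDE.curl (u t) y‖} → ρ' ≤ 2 * ρ) → ∀ e : EuclideanSpace ℝ (Fin 3), ‖e‖ = 1 → |inner ℝ ((fderiv ℝ (u t) x - fderiv ℝ (fun z : EuclideanSpace ℝ (Fin 3) => ∫ y, (4 * Real.pi * ‖z - y‖ ^ 3)⁻¹ • Literature.Analysis.FluidPDE.cross ((Metric.ball x (M * ρ)).indicator (Literature.Analysis.FluidPDE.curl (u t)) y) (z - y)) x) e) e| ≤ g t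

/-- item stmt-NavierStokesRegularity-0055 · support · rank 9 · closed · proved by Summit.NavierStokesRegularity.NavierStokesRegularity.Theorems.typeICertificateLadder_noBlowupToClay_proof @ f501e9774e4d (prover) · by planner
sources: Leray1934, Fefferman2000, CaffarelliKohnNirenberg1982
Given NoBlowup, build the Clay (A) solution: local finite-energy classical solution for smooth
divergence-free rapidly decaying data (Leray 1934 §III / Fujita–Kato 1964 + LPS smoothing), continue
past every T using NoBlowup, glue by weak–strong uniqueness (Prodi–Serrin), bounded energy from the
energy inequality, and convert with
Literature.Analysis.FluidPDE.isNavierStokesSolution_and_smooth_iff. Blow-up at spatial infinity is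
excluded by CKN ε-regularity applied far out. May take named Literature facts (leray_existence_R3,
ladyzhenskaya_prodi_serrin, weak_strong_uniqueness, fujita_kato_local) as hypotheses if the grounder
so rules. -/
@[route_item "route-NavierStokesRegularity-CoreLogGas", crux]
def NoBlowupToClay : Prop :=
  (∀ (ν T : ℝ), 0 < ν → 0 < T → ∀ (u : ℝ → EuclideanSpace ℝ (Fin 3) → EuclideanSpace ℝ (Fin 3)) (p : ℝ → EuclideanSpace ℝ (Fin 3) → ℝ), Literature.Analysis.FluidPDE.IsClassicalNSSolutionOn (Set.Ico 0 T) ν 0 u p → Literature.Analysis.FluidPDE.IsLerayHopfOn T ν 0 (u 0) u → Literature.Analysis.FluidPDE.HasRapidSpatialDecay (u 0) → Literature.Analysis.FluidPDE.HasSmoothExtensionPast ν 0 u T) → NavierStokesRegularity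

/-- `NoBlowupToClay` holds: proved by `Summit.NavierStokesRegularity.NavierStokesRegularity.Theorems.typeICertificateLadder_noBlowupToClay_proof` @ f501e9774e4d. -/
theorem NoBlowupToClay_holds : NoBlowupToClay := _root_.Summit.NavierStokesRegularity.NavierStokesRegularity.Theorems.typeICertificateLadder_noBlowupToClay_proof

/-- item stmt-NavierStokesRegularity-2089 · support · rank 9 · closed · proved by Summit.NavierStokesRegularity.NavierStokesRegularity.Theorems.coreLogGas_logGasNoVacuum_proof @ d9976566dae5 (prover) · by planner
sources: LundgrenAshurst1989, Benjamin1962, Marshall1991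
[support] LOG-GAS COMPARISON INEQUALITY — the Riemann invariants of the forced Lundgren–Ashurst core
system (LundgrenAshurst1989: core area A, axial velocity w, cyclostrophic pressure −κ/A, κ = Γ²/4π;
1-D isentropic gas with P = κ ln A, sound speed c = (κ/A)^{1/2} = peak swirl speed; Benjamin1962
super/subcritical cores = w ≷ c). For ANY C¹ pair (A,w), L-periodic in s, with A > 0 on [0,T)×ℝ,
define the residuals σ̃ := −(A_t + A_s w + A w_s)/A (external axial strain) and f̃ := w_t + w w_s +
κA_s/A² (external axial acceleration). Then EXACTLY (w+2c)_t + (w−c)(w+2c)_s = f̃ + σ̃c and (w−2c)_t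
+ (w+c)(w−2c)_s = f̃ − σ̃c, so M(t) := sup_s(w+2c)(t,·) − inf_s(w−2c)(t,·) ≥ 4 sup_s c(t,·) has
upper Dini derivative ≤ 2F + SM/2 when |σ̃| ≤ S, |f̃| ≤ F (Danskin at the extremal points, where the
s-derivative vanishes), and Grönwall gives the statement 4c(t,s) ≤ (M(0) + 2Ft)·e^{St/2}: NO VACUUM
(A(t,s) ≥ 16κ e^{−St}/(M(0)+2Ft)²) under bounded residuals, amplification at most exponential in
½∫S. Provable now (1-D real analysis: envelope theorem for a max over a period + Grönwall for Dini
derivatives, or characteristics). Deliberately NOT claimed for weak/shock solutions: for P = κ ln A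
the regions -/
@[route_item "route-NavierStokesRegularity-CoreLogGas"]
def LogGasNoVacuum : Prop :=
  ∀ (κ L T F S : ℝ), 0 < κ → 0 < L → 0 < T → 0 ≤ F → 0 ≤ S → ∀ (A w : ℝ → ℝ → ℝ), ContDiff ℝ 1 (Function.uncurry A) → ContDiff ℝ 1 (Function.uncurry w) → (∀ t, Function.Periodic (A t) L) → (∀ t, Function.Periodic (w t) L) → (∀ t ∈ Set.Ico 0 T, ∀ s, 0 < A t s) → (∀ t ∈ Set.Ico 0 T, ∀ s, |deriv (fun τ => A τ s) t + deriv (fun y => A t y) s * w t s + A t s * deriv (fun y => w t y) s| ≤ S * A t s ∧ |deriv (fun τ => w τ s) t + w t s * deriv (fun y => w t y) s + κ * deriv (fun y => A t y) s / (A t s) ^ 2| ≤ F) → ∀ t ∈ Set.Ico 0 T, ∀ s, 4 * Real.sqrt (κ / A t s) ≤ ((⨆ y, (w 0 y + 2 * Real.sqrt (κ / A 0 y))) - (⨅ y, (w 0 y - 2 * Real.sqrt (κ / A 0 y))) + 2 * F * t) * Real.exp (S * t / 2)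

/-- item stmt-NavierStokesRegularity-2090 · support · rank 9 · closed · proved by Summit.NavierStokesRegularity.NavierStokesRegularity.Theorems.coreLogGas_coreReductionContinuation_proof (prover) · by planner
sources: BealeKatoMajda1984, MajdaBertozzi2002, LundgrenAshurst1989
[support] CORE-REDUCTION CONTINUATION = LogGasNoVacuum + Beale–Kato–Majda. If on some [t₀,T) the
vorticity maximum of a finite-energy classical solution from Clay data is dominated by K·sup_s
κ/A(t,s) (= K·sup c², i.e. |ω|_max ≲ Γ/A_min: the peak sits in the core) for a log-gas pair (A,w)
with residual bounds (S,F), then sup c is bounded on [t₀,T) by LogGasNoVacuum (time-shifted to t₀),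
so ‖ω(t)‖∞ is bounded on [t₀,T), and on [0,t₀] by BKM-class persistence of Schwartz regularity
(in-tree HasBoundedSobolevNormsOn; standard), hence ∫₀ᵀ‖ω‖∞ < ∞ and the solution continues: in-tree
beale_kato_majda / hasSobolevExtensionPast_of_parts (MajdaBertozzi2002_localExistenceH3,
_uniquenessSobolev, _bkmAprioriH3) and HasSobolevExtensionPast.hasSmoothExtensionPast. May take
those named facts and Schwartz persistence as hypotheses if the grounder so rules. This is the
formal socket through which the layer-2 validity item (the TRUE core area and axial velocity of a
lone slender tube satisfy these hypotheses) would exclude the lone-tube branch of crux B. -/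
@[route_item "route-NavierStokesRegularity-CoreLogGas"]
def CoreReductionContinuation : Prop :=
  ∀ (ν T : ℝ), 0 < ν → 0 < T → ∀ (u : ℝ → EuclideanSpace ℝ (Fin 3) → EuclideanSpace ℝ (Fin 3)) (p : ℝ → EuclideanSpace ℝ (Fin 3) → ℝ), Literature.Analysis.FluidPDE.IsClassicalNSSolutionOn (Set.Ico 0 T) ν 0 u p → Literature.Analysis.FluidPDE.IsLerayHopfOn T ν 0 (u 0) u → Literature.Analysis.FluidPDE.HasRapidSpatialDecay (u 0) → (∃ (κ L K t₀ F S : ℝ) (A w : ℝ → ℝ → ℝ), 0 < κ ∧ 0 < L ∧ 0 ≤ t₀ ∧ t₀ < T ∧ ContDiff ℝ 1 (Function.uncurry A) ∧ ContDiff ℝ 1 (Function.uncurry w) ∧ (∀ t, Function.Periodic (A t) L ∧ Function.Periodic (w t) L) ∧ (∀ t ∈ Set.Ico t₀ T, ∀ s, 0 < A t s ∧ |deriv (fun τ => A τ s) t + deriv (fun y => A t y) s * w t s + A t s * deriv (fun y => w t y) s| ≤ S * A t s ∧ |deriv (fun τ => w τ s) t + w t s * deriv (fun y => w t y) s + κ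 * deriv (fun y => A t y) s / (A t s) ^ 2| ≤ F) ∧ (∀ t ∈ Set.Ico t₀ T, ∀ x, ‖Literature.Analysis.FluidPDE.curl (u t) x‖ ≤ K * ⨆ s, κ / A t s)) → Literature.Analysis.FluidPDE.HasSmoothExtensionPast ν 0 u T

-- earlier Assembly (stmt-NavierStokesRegularity-2086, replaced 2026-08-15T16:59:44Z -> stmt-NavierStokesRegularity-11292): retired by None — LocallyDrivenIsTypeI → BlowupIsLocallyDriven → Liouville → LiouvilleKillsTypeI → NoBlowupToClay → NavierStokesRegularity
/-- item stmt-NavierStokesRegularity-11292 · assembly · rank 1 · closed · proved by Summit.NavierStokesRegularity.NavierStokesRegularity.Theorems.coreLogGas_assembly_proof (prover) · by planner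
sources: KNSS2009, Fefferman2000
[assembly] LocallyDrivenIsTypeI → BlowupIsLocallyDriven → NoTypeIBlowup → NoBlowupToClay →
NavierStokesRegularity — the bookkeeping mirror of the route's deciding theorem `closes` (D-0027
§2.1), which is PROVED sorry-free in the route file with exactly these hypotheses (pure logic: fix
ν,T,u,p as in NoBlowupToClay's hypothesis; if u had no smooth extension past T then (u,p) is
IsMaximalSmoothSolution, B supplies the locality hypothesis H, A gives IsTypeIBlowup u T,
NoTypeIBlowup gives HasSmoothExtensionPast — contradiction; NoBlowupToClay (stmt-0055) converts to
Clay (A)). A prover closes this item in one line: `theorem … : Assembly := closes`. Rev 3: replaces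
the rev-1 chain through Liouville / LiouvilleKillsTypeI (dropped from this route). -/
@[route_item "route-NavierStokesRegularity-CoreLogGas"]
def Assembly : Prop :=
  LocallyDrivenIsTypeI → BlowupIsLocallyDriven → NoTypeIBlowup → NoBlowupToClay → NavierStokesRegularity

/-! D-0027 §2.1 — DECIDING THEOREM (planner-authored via `route open/edit --closes-file`; by planner-rbadge-NavierStokesRegularity-CoreLogG-1741f1bb-g2-0 2026-08-15T16:59:44Z):
its hypotheses are this route's items and its conclusion the sub-problem Statement (glue_lint), and it elaborates with this file. -/

/-- D-0027 §2.1 deciding theorem of route CoreLogGas: pure logic. Fix `ν, T, u, p` as in the continuation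
criterion that `NoBlowupToClay` consumes; if `u` had no smooth extension past `T`, then `(u, p)` is a maximal
smooth solution, `BlowupIsLocallyDriven` (B) supplies the locality hypothesis H, `LocallyDrivenIsTypeI` (A) turns
it into a Type-I blow-up rate, and `NoTypeIBlowup` (Type-I exclusion, shared stmt-1217) extends the solution past
`T` — contradiction. Hence every such solution extends, and `NoBlowupToClay` gives Clay (A).
Axioms: propext, Classical.choice, Quot.sound. -/
@[closes "route-NavierStokesRegularity-CoreLogGas"] theorem closes (hA : LocallyDrivenIsTypeI) (hB : BlowupIsLocallyDriven) (hI : NoTypeIBlowup)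
    (hC : NoBlowupToClay) : _root_.NavierStokesRegularity := by
  refine hC ?_
  intro ν T hν hT u p hcl hlh hdec
  by_contra hne
  have hmax : Literature.Analysis.FluidPDE.IsMaximalSmoothSolution ν 0 u p T := ⟨hcl, hne⟩
  exact hne (hI ν T hν hT u p hcl hlh hdec
    (hA ν T hν hT u p hmax hlh hdec (hB ν T hν hT u p hmax hlh hdec)))

end Summit.NavierStokesRegularity.NavierStokesRegularity.Theses.CoreLogGas
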